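import Mathlib
import Summits.NavierStokesRegularity.NavierStokesRegularity.Theorems.EulerZoomLiouvillePowerGaugeEulerLiouvilleHoopDefs
import Summits.NavierStokesRegularity.NavierStokesRegularity.Theorems.EulerZoomLiouvillePowerGaugeEulerLiouvilleHoopFrame
import Summits.NavierStokesRegularity.NavierStokesRegularity.Theorems.EulerZoomLiouvillePowerGaugeEulerLiouvilleCondenserQuietPlane
import Literature.Analysis.FluidPDE.PeriodicCylinderCoordinates
import HarnessLib

/-!
# HOOP LINE, H-CYL BASE — cylinder coordinates on the solid cylinder `solidCyl` (route `EulerZoomLiouville`,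
# crux E = stmt-NavierStokesRegularity-19832; class-free measure theory, `--supports` only)

The measure-theoretic half of the K-HOOP assembly step (c) «H-CYL» (LEAD 19832 ns-typeII-p2 g14 KEY K-HOOP
01:25:31Z; split ezl-w2 g5 01:31:33Z): the change of variables to cylinder coordinates `(σ, t, θ) ↦ axisPt σ t θ`
about the radial `x₂`-axis for the objects of `…HoopDefs` (`solidCyl`, `axisPt`, `circleAvg`).

* `axisPt_eq_toLp`, `periodic_axisPt`, `continuous_axisPt` — the point `axisPt σ t θ = (t cos θ, t sin θ, σ)` (its components,
  `cylRadius_axisPt` and `axisPt_mem_solidCyl` are ezl-w3 g6's `…HoopFrame`, imported);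
* `measurableSet_solidCyl`, `isClosed_solidCyl`, `isCompact_solidCyl`;
* `hasFDerivAt_prod_polarCoord_symm`, `integrableOn_image_prod_polarCoord_symm_iff` — integrability under polar
  coordinates with a parameter on `ℝ × (ℝ × ℝ)` (Mathlib's `polarCoord`, Jacobian `t`; the integral identity itself is
  `Literature.Analysis.FluidPDE.integral_comp_cylPolar` of `PeriodicCylinderCoordinates`, imported);
* `setIntegral_solidCyl_eq_setIntegral_box` — **the cylinder formula, product form (no integrability needed)**:
  `∫_{solidCyl s₁ s₂ T₀} f = ∫_{(σ,t,θ) ∈ [s₁,s₂] × (0,T₀] × (−π,π)} t • f (axisPt σ t θ)`;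
* `integrableOn_solidCyl_iff` — `f` is integrable on the solid cylinder iff `t • f (axisPt σ t θ)` is integrable on
  the box (this is how the integrability of the atom-subtracted `hoopDensity` at the axis is to be checked);
* `setIntegral_solidCyl_eq` — **iterated form**: for `f` integrable on the cylinder, `s₁ ≤ s₂`, `0 ≤ T₀`,
  `∫_{solidCyl} f = ∫_{s₁}^{s₂} ∫₀^{T₀} t • ∫₀^{2π} f (axisPt σ t θ) dθ dt dσ`, and `setIntegral_solidCyl_eq_circleAvg` —
  the same with the azimuthal average: `= 2π ∫_{s₁}^{s₂} ∫₀^{T₀} t · circleAvg f σ t dt dσ`.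

Route: the volume-preserving slicing `Condenser.planeEquiv : E³ ≃ᵐ ℝ × E²` (tree, `…CondenserQuietPlane`) and
`E² ≃ᵐ ℝ × ℝ`, then polar coordinates in the second factor (`Literature…PeriodicCylinderCoordinates`:
`integral_comp_cylPolar`, `det_id_prodMap_fderivPolarCoordSymm`, `univ_prod_polarCoord_source_ae_eq_univ`) and Mathlib's
`integrableOn_image_iff_integrableOn_abs_det_fderiv_smul` for `id × polarCoord.symm` (Jacobian `t`), and
`Function.Periodic.intervalIntegral_add_eq` to move the angle window from `(−π, π)` to `(0, 2π)`.  (The Literature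
file integrates over all of `ℝ³` in the `cylCoord` chart about the `x₂`-axis; here the region is the finite solid
cylinder of `…HoopDefs` and the chart is `axisPt`, with the integrability transfer the hoop assembly needs.)

HONEST FRAME: tool lemmas (change of variables) for the hoop line; nothing here is specific to Euler or
Navier–Stokes; 19832 OPEN; NS regularity NOT proved.  [folklore (cylinder coordinates, Fubini)]
-/

noncomputable section

open MeasureTheory Set WithLp Metric Real
open scoped InnerProductSpace RealInnerProductSpace

set_option linter.dupNamespace false

namespace Summit.NavierStokesRegularity.NavierStokesRegularity.Theorems.PowerGaugeEulerLiouville.HoopCore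

open Literature.Analysis.FluidPDE Condenser

/-! ### The cylinder-coordinate point `axisPt σ t θ = (t cos θ, t sin θ, σ)` -/

/-- `axisPt s t θ = (t cos θ, t sin θ, s)` as a `toLp` literal (companion of `HoopCore.axisPt_eq` / `axisPt_apply` of
`…HoopFrame`, in the form matching `polarCoord.symm`). [folklore] -/
theorem axisPt_eq_toLp (s t θ : ℝ) : axisPt s t θ = toLp 2 ![t * Real.cos θ, t * Real.sin θ, s] := by
  obtain ⟨h0, h1, h2⟩ := axisPt_apply s t θ
  ext i
  fin_cases i
  · simpa using h0
  · simpa using h1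
  · simpa using h2

/-- The angle is `2π`-periodic: `axisPt s t (θ + 2π) = axisPt s t θ`. [folklore] -/
theorem periodic_axisPt (s t : ℝ) : Function.Periodic (axisPt s t) (2 * π) := by
  intro θ
  rw [axisPt_eq_toLp, axisPt_eq_toLp, Real.cos_add_two_pi, Real.sin_add_two_pi]

/-- `(σ, t, θ) ↦ axisPt σ t θ` is continuous. [folklore] -/
theorem continuous_axisPt : Continuous fun p : ℝ × ℝ × ℝ => axisPt p.1 p.2.1 p.2.2 := by
  simp_rw [axisPt_eq_toLp]
  refine (PiLp.continuous_toLp 2 _).comp (continuous_pi fun i => ?_)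
  fin_cases i
  · exact (continuous_fst.comp continuous_snd).mul (Real.continuous_cos.comp (continuous_snd.comp continuous_snd))
  · exact (continuous_fst.comp continuous_snd).mul (Real.continuous_sin.comp (continuous_snd.comp continuous_snd))
  · exact continuous_fst

/-! ### The solid cylinder -/

/-- `solidCyl s₁ s₂ T₀` is a closed set. [folklore] -/
theorem isClosed_solidCyl (s₁ s₂ T₀ : ℝ) : IsClosed (solidCyl s₁ s₂ T₀) := by
  have h2 : Continuous fun y : EuclideanSpace ℝ (Fin 3) => y 2 := PiLp.continuous_apply 2 _ 2
  simp only [solidCyl, setOf_and]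
  exact (isClosed_le continuous_const h2).inter ((isClosed_le h2 continuous_const).inter
    (isClosed_le continuous_cylRadius continuous_const))

/-- `solidCyl s₁ s₂ T₀` is measurable. [folklore] -/
theorem measurableSet_solidCyl (s₁ s₂ T₀ : ℝ) : MeasurableSet (solidCyl s₁ s₂ T₀) :=
  (isClosed_solidCyl s₁ s₂ T₀).measurableSet

/-- `solidCyl s₁ s₂ T₀` is compact (closed and bounded: `‖y‖² = cylRadius y ² + y₂²`). [folklore] -/
theorem isCompact_solidCyl (s₁ s₂ T₀ : ℝ) : IsCompact (solidCyl s₁ s₂ T₀) := by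
  refine Metric.isCompact_of_isClosed_isBounded (isClosed_solidCyl s₁ s₂ T₀) ?_
  refine (Metric.isBounded_closedBall (x := (0 : EuclideanSpace ℝ (Fin 3)))
    (r := |T₀| + (|s₁| + |s₂|))).subset fun y hy => ?_
  obtain ⟨h1, h2, h3⟩ := hy
  rw [mem_closedBall, dist_zero_right]
  have hn : ‖y‖ ^ 2 = cylRadius y ^ 2 + (y 2) ^ 2 := by
    rw [EuclideanSpace.norm_sq_eq, Fin.sum_univ_three, cylRadius_sq]
    simp only [Real.norm_eq_abs, sq_abs]
  have hc : cylRadius y ≤ |T₀| := h3.trans (le_abs_self T₀)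
  have hc0 := cylRadius_nonneg y
  have hy2 : |y 2| ≤ |s₁| + |s₂| := by
    rcases le_or_gt 0 (y 2) with h | h
    · rw [abs_of_nonneg h]; linarith [le_abs_self s₂, abs_nonneg s₁]
    · rw [abs_of_neg h]; linarith [neg_abs_le s₁, abs_nonneg s₂]
  nlinarith [norm_nonneg y, abs_nonneg T₀, abs_nonneg (y 2), sq_abs (y 2), abs_nonneg s₁, abs_nonneg s₂]

/-! ### Polar coordinates with a parameter on `ℝ × (ℝ × ℝ)` -/

/-- The map `(σ, (t, θ)) ↦ (σ, (t cos θ, t sin θ))` (identity times `polarCoord.symm`) has derivative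
`id × fderivPolarCoordSymm (t, θ)`. [folklore] -/
theorem hasFDerivAt_prod_polarCoord_symm (p : ℝ × (ℝ × ℝ)) :
    HasFDerivAt (fun q : ℝ × (ℝ × ℝ) => (q.1, polarCoord.symm q.2))
      ((ContinuousLinearMap.id ℝ ℝ).prodMap (fderivPolarCoordSymm p.2)) p :=
  (hasFDerivAt_id p.1).prodMap p (hasFDerivAt_polarCoord_symm p.2)

/-- **Integrability under polar coordinates with a parameter**: for a measurable `S ⊆ ℝ × ((0,∞) × (−π,π))`,
`g` is integrable on the image `{(σ, (t cos θ, t sin θ)) : (σ, (t, θ)) ∈ S}` iff `t • g (σ, (t cos θ, t sin θ))` is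
integrable on `S`. [folklore] -/
theorem integrableOn_image_prod_polarCoord_symm_iff {F : Type*} [NormedAddCommGroup F] [NormedSpace ℝ F]
    (g : ℝ × (ℝ × ℝ) → F) {S : Set (ℝ × (ℝ × ℝ))} (hS : MeasurableSet S)
    (hSt : S ⊆ (univ : Set ℝ) ×ˢ polarCoord.target) :
    IntegrableOn g ((fun q : ℝ × (ℝ × ℝ) => (q.1, polarCoord.symm q.2)) '' S) ↔
      IntegrableOn (fun p : ℝ × (ℝ × ℝ) => p.2.1 • g (p.1, polarCoord.symm p.2)) S := by
  have hD : ∀ p ∈ S, HasFDerivWithinAt (fun q : ℝ × (ℝ × ℝ) => (q.1, polarCoord.symm q.2))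
      ((ContinuousLinearMap.id ℝ ℝ).prodMap (fderivPolarCoordSymm p.2)) S p :=
    fun p _ => (hasFDerivAt_prod_polarCoord_symm p).hasFDerivWithinAt
  have hinj : InjOn (fun q : ℝ × (ℝ × ℝ) => (q.1, polarCoord.symm q.2)) S := by
    intro a ha b hb hab
    simp only [Prod.mk.injEq] at hab
    exact Prod.ext hab.1 (polarCoord.symm.injOn (mem_prod.1 (hSt ha)).2 (mem_prod.1 (hSt hb)).2 hab.2)
  rw [integrableOn_image_iff_integrableOn_abs_det_fderiv_smul volume hS hD hinj g]
  refine integrableOn_congr_fun (fun p hp => ?_) hS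
  rw [det_id_prodMap_fderivPolarCoordSymm p, abs_of_pos (mem_prod.1 (hSt hp)).2.1]

/-! ### Transport to `E³`: the solid cylinder in cylinder coordinates -/

/-- The identification `E³ ≃ᵐ ℝ × (ℝ × ℝ)`, `y ↦ (y₂, (y₀, y₁))` (slicing `Condenser.planeEquiv` followed by
`E² ≃ᵐ ℝ × ℝ`) preserves Lebesgue measure. [folklore] -/
theorem measurePreserving_planeEquiv_prod :
    MeasurePreserving (Condenser.planeEquiv.trans (MeasurableEquiv.prodCongr (MeasurableEquiv.refl ℝ)
      ((MeasurableEquiv.toLp 2 (Fin 2 → ℝ)).symm.trans MeasurableEquiv.finTwoArrow))) volume volume := by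
  refine measurePreserving_planeEquiv.trans ?_
  have hT : MeasurePreserving ((MeasurableEquiv.toLp 2 (Fin 2 → ℝ)).symm.trans MeasurableEquiv.finTwoArrow)
      volume volume :=
    (EuclideanSpace.volume_preserving_symm_measurableEquiv_toLp (Fin 2)).trans (volume_preserving_finTwoArrow ℝ)
  exact (MeasurePreserving.id (volume : Measure ℝ)).prod hT

/-- The inverse identification sends `(σ, (a, b))` to the point `(a, b, σ)`. [folklore] -/
theorem planeEquiv_prod_symm_apply (σ a b : ℝ) :
    (Condenser.planeEquiv.trans (MeasurableEquiv.prodCongr (MeasurableEquiv.refl ℝ)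
      ((MeasurableEquiv.toLp 2 (Fin 2 → ℝ)).symm.trans MeasurableEquiv.finTwoArrow))).symm (σ, (a, b))
      = toLp 2 ![a, b, σ] := by
  change Condenser.planeEquiv.symm
      (σ, ((MeasurableEquiv.toLp 2 (Fin 2 → ℝ)).symm.trans MeasurableEquiv.finTwoArrow).symm (a, b)) = _
  rw [Condenser.planeEquiv_symm_apply]
  ext i
  fin_cases i <;> rfl

/-- In particular `(σ, (t, θ)) ↦ axisPt σ t θ` is the inverse identification composed with `id × polarCoord.symm`.
[folklore] -/
theorem planeEquiv_prod_symm_polarCoord_symm (p : ℝ × (ℝ × ℝ)) :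
    (Condenser.planeEquiv.trans (MeasurableEquiv.prodCongr (MeasurableEquiv.refl ℝ)
      ((MeasurableEquiv.toLp 2 (Fin 2 → ℝ)).symm.trans MeasurableEquiv.finTwoArrow))).symm
        (p.1, polarCoord.symm p.2) = axisPt p.1 p.2.1 p.2.2 := by
  rw [polarCoord_symm_apply, planeEquiv_prod_symm_apply, axisPt_eq_toLp]

/-- The coordinate box `[s₁, s₂] × ((0, T₀] × (−π, π))` lies in `ℝ × polarCoord.target`. [folklore] -/
theorem box_subset_univ_prod_polarCoord_target (s₁ s₂ T₀ : ℝ) :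
    Icc s₁ s₂ ×ˢ (Ioc 0 T₀ ×ˢ Ioo (-π) π) ⊆ (univ : Set ℝ) ×ˢ polarCoord.target := by
  rintro ⟨σ, t, θ⟩ ⟨-, ⟨ht, -⟩, hθ⟩
  exact ⟨mem_univ _, ht, hθ⟩

/-- The coordinate box is measurable. [folklore] -/
theorem measurableSet_box (s₁ s₂ T₀ : ℝ) :
    MeasurableSet (Icc s₁ s₂ ×ˢ (Ioc 0 T₀ ×ˢ Ioo (-π) π) : Set (ℝ × (ℝ × ℝ))) :=
  measurableSet_Icc.prod (measurableSet_Ioc.prod measurableSet_Ioo)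

/-- Pointwise bookkeeping: on `ℝ × polarCoord.target`, the pulled-back indicator of the solid cylinder is the
indicator of the coordinate box. [folklore] -/
theorem indicator_solidCyl_axisPt {F : Type*} [NormedAddCommGroup F] [NormedSpace ℝ F]
    (f : EuclideanSpace ℝ (Fin 3) → F) (s₁ s₂ T₀ : ℝ) {p : ℝ × (ℝ × ℝ)}
    (hp : p ∈ (univ : Set ℝ) ×ˢ polarCoord.target) :
    p.2.1 • (solidCyl s₁ s₂ T₀).indicator f (axisPt p.1 p.2.1 p.2.2)
      = (Icc s₁ s₂ ×ˢ (Ioc 0 T₀ ×ˢ Ioo (-π) π)).indicator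
          (fun p : ℝ × (ℝ × ℝ) => p.2.1 • f (axisPt p.1 p.2.1 p.2.2)) p := by
  have ht : 0 < p.2.1 := (mem_prod.1 hp).2.1
  have hθ : p.2.2 ∈ Ioo (-π) π := (mem_prod.1 hp).2.2
  by_cases hm : s₁ ≤ p.1 ∧ p.1 ≤ s₂ ∧ p.2.1 ≤ T₀
  · have h1 : axisPt p.1 p.2.1 p.2.2 ∈ solidCyl s₁ s₂ T₀ := (axisPt_mem_solidCyl ht.le _).2 hm
    have h2 : p ∈ Icc s₁ s₂ ×ˢ (Ioc 0 T₀ ×ˢ Ioo (-π) π) := ⟨⟨hm.1, hm.2.1⟩, ⟨ht, hm.2.2⟩, hθ⟩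
    rw [indicator_of_mem h1, indicator_of_mem h2]
  · have h1 : axisPt p.1 p.2.1 p.2.2 ∉ solidCyl s₁ s₂ T₀ := fun h => hm ((axisPt_mem_solidCyl ht.le _).1 h)
    have h2 : p ∉ Icc s₁ s₂ ×ˢ (Ioc 0 T₀ ×ˢ Ioo (-π) π) := fun h => hm ⟨h.1.1, h.1.2, h.2.1.2⟩
    rw [indicator_of_notMem h1, indicator_of_notMem h2, smul_zero]

/-- **THE CYLINDER FORMULA, product form** (no integrability needed): for every `f : E³ → F`,
`∫_{solidCyl s₁ s₂ T₀} f = ∫_{(σ,(t,θ)) ∈ [s₁,s₂] × ((0,T₀] × (−π,π))} t • f (axisPt σ t θ)`. [folklore] -/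
theorem setIntegral_solidCyl_eq_setIntegral_box {F : Type*} [NormedAddCommGroup F] [NormedSpace ℝ F]
    (f : EuclideanSpace ℝ (Fin 3) → F) (s₁ s₂ T₀ : ℝ) :
    ∫ y in solidCyl s₁ s₂ T₀, f y
      = ∫ p in Icc s₁ s₂ ×ˢ (Ioc 0 T₀ ×ˢ Ioo (-π) π), p.2.1 • f (axisPt p.1 p.2.1 p.2.2) := by
  set Φ := Condenser.planeEquiv.trans (MeasurableEquiv.prodCongr (MeasurableEquiv.refl ℝ)
      ((MeasurableEquiv.toLp 2 (Fin 2 → ℝ)).symm.trans MeasurableEquiv.finTwoArrow)) with hΦ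
  have hΦmp : MeasurePreserving Φ volume volume := measurePreserving_planeEquiv_prod
  have h1 : ∫ y in solidCyl s₁ s₂ T₀, f y = ∫ q, (solidCyl s₁ s₂ T₀).indicator f (Φ.symm q) := by
    rw [← integral_indicator (measurableSet_solidCyl s₁ s₂ T₀)]
    exact (hΦmp.symm.integral_comp' (g := (solidCyl s₁ s₂ T₀).indicator f)).symm
  rw [h1, ← integral_comp_cylPolar]
  calc ∫ p in (univ : Set ℝ) ×ˢ polarCoord.target,
        p.2.1 • (solidCyl s₁ s₂ T₀).indicator f (Φ.symm (p.1, polarCoord.symm p.2))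
      = ∫ p in (univ : Set ℝ) ×ˢ polarCoord.target, (Icc s₁ s₂ ×ˢ (Ioc 0 T₀ ×ˢ Ioo (-π) π)).indicator
          (fun p : ℝ × (ℝ × ℝ) => p.2.1 • f (axisPt p.1 p.2.1 p.2.2)) p := by
        refine setIntegral_congr_fun (MeasurableSet.univ.prod polarCoord.open_target.measurableSet)
          fun p hp => ?_
        rw [hΦ, planeEquiv_prod_symm_polarCoord_symm, indicator_solidCyl_axisPt f s₁ s₂ T₀ hp]
    _ = ∫ p in Icc s₁ s₂ ×ˢ (Ioc 0 T₀ ×ˢ Ioo (-π) π), p.2.1 • f (axisPt p.1 p.2.1 p.2.2) := by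
        rw [setIntegral_indicator (measurableSet_box s₁ s₂ T₀),
          inter_eq_right.mpr (box_subset_univ_prod_polarCoord_target s₁ s₂ T₀)]

/-- **Integrability on the solid cylinder** ⇔ integrability of `t • f (axisPt σ t θ)` on the coordinate box
`[s₁,s₂] × ((0,T₀] × (−π,π))`.  (For the atom-subtracted hoop density this reduces integrability at the axis to the
boundedness of `t · hoopDensity V (axisPt σ t θ)`.) [folklore] -/
theorem integrableOn_solidCyl_iff {F : Type*} [NormedAddCommGroup F] [NormedSpace ℝ F]
    (f : EuclideanSpace ℝ (Fin 3) → F) (s₁ s₂ T₀ : ℝ) :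
    IntegrableOn f (solidCyl s₁ s₂ T₀)
      ↔ IntegrableOn (fun p : ℝ × (ℝ × ℝ) => p.2.1 • f (axisPt p.1 p.2.1 p.2.2))
          (Icc s₁ s₂ ×ˢ (Ioc 0 T₀ ×ˢ Ioo (-π) π)) := by
  set Φ := Condenser.planeEquiv.trans (MeasurableEquiv.prodCongr (MeasurableEquiv.refl ℝ)
      ((MeasurableEquiv.toLp 2 (Fin 2 → ℝ)).symm.trans MeasurableEquiv.finTwoArrow)) with hΦ
  have hΦmp : MeasurePreserving Φ volume volume := measurePreserving_planeEquiv_prod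
  set g : ℝ × (ℝ × ℝ) → F := fun q => (solidCyl s₁ s₂ T₀).indicator f (Φ.symm q) with hg
  -- (1) integrable on the cylinder ⇔ the pulled-back indicator is integrable on `ℝ × (ℝ × ℝ)`
  have h1 : IntegrableOn f (solidCyl s₁ s₂ T₀) ↔ Integrable g := by
    rw [← integrable_indicator_iff (measurableSet_solidCyl s₁ s₂ T₀), hg]
    exact (hΦmp.symm.integrable_comp_emb Φ.symm.measurableEmbedding).symm
  -- (2) … ⇔ integrable on `ℝ × polarCoord.source`, the image of `ℝ × polarCoord.target`
  have himage : (fun q : ℝ × (ℝ × ℝ) => (q.1, polarCoord.symm q.2)) '' ((univ : Set ℝ) ×ˢ polarCoord.target)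
      = (univ : Set ℝ) ×ˢ polarCoord.source := by
    have hfun : (fun q : ℝ × (ℝ × ℝ) => (q.1, polarCoord.symm q.2)) = Prod.map id polarCoord.symm := rfl
    rw [hfun, Set.prodMap_image_prod, image_id, polarCoord.symm_image_target_eq_source]
  have h2 : Integrable g ↔
      IntegrableOn g ((fun q : ℝ × (ℝ × ℝ) => (q.1, polarCoord.symm q.2)) '' ((univ : Set ℝ) ×ˢ polarCoord.target)) := by
    rw [himage, ← integrableOn_univ, integrableOn_congr_set_ae univ_prod_polarCoord_source_ae_eq_univ]
  -- (3) change of variables, then indicator bookkeeping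
  rw [h1, h2, integrableOn_image_prod_polarCoord_symm_iff g
    (MeasurableSet.univ.prod polarCoord.open_target.measurableSet) subset_rfl]
  have h3 : IntegrableOn (fun p : ℝ × (ℝ × ℝ) => p.2.1 • g (p.1, polarCoord.symm p.2))
      ((univ : Set ℝ) ×ˢ polarCoord.target) ↔
      IntegrableOn ((Icc s₁ s₂ ×ˢ (Ioc 0 T₀ ×ˢ Ioo (-π) π)).indicator
        (fun p : ℝ × (ℝ × ℝ) => p.2.1 • f (axisPt p.1 p.2.1 p.2.2))) ((univ : Set ℝ) ×ˢ polarCoord.target) := by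
    refine integrableOn_congr_fun (fun p hp => ?_) (MeasurableSet.univ.prod polarCoord.open_target.measurableSet)
    simp only [hg]
    rw [hΦ, planeEquiv_prod_symm_polarCoord_symm, indicator_solidCyl_axisPt f s₁ s₂ T₀ hp]
  rw [h3, IntegrableOn, integrable_indicator_iff (measurableSet_box s₁ s₂ T₀), IntegrableOn,
    Measure.restrict_restrict (measurableSet_box s₁ s₂ T₀),
    inter_eq_left.mpr (box_subset_univ_prod_polarCoord_target s₁ s₂ T₀)]
  rfl

/-! ### Iterated form -/

/-- The angular integral over `(−π, π)` with the Jacobian pulled out and the window moved to `(0, 2π)`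
(the integrand is `2π`-periodic in `θ`): `∫_{θ ∈ (−π,π)} t • f (axisPt σ t θ) = t • ∫₀^{2π} f (axisPt σ t θ) dθ`.
[folklore] -/
theorem setIntegral_Ioo_smul_axisPt {F : Type*} [NormedAddCommGroup F] [NormedSpace ℝ F]
    (f : EuclideanSpace ℝ (Fin 3) → F) (σ t : ℝ) :
    ∫ θ in Ioo (-π) π, t • f (axisPt σ t θ) = t • ∫ θ in (0 : ℝ)..2 * π, f (axisPt σ t θ) := by
  rw [integral_smul, setIntegral_congr_set (Ioo_ae_eq_Ioc : Ioo (-π) π =ᵐ[(volume : Measure ℝ)] Ioc (-π) π),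
    ← intervalIntegral.integral_of_le (by linarith [pi_pos] : -π ≤ π)]
  congr 1
  have hper : Function.Periodic (fun θ => f (axisPt σ t θ)) (2 * π) := (periodic_axisPt σ t).comp f
  have h := hper.intervalIntegral_add_eq (-π) 0
  rw [show -π + 2 * π = π by ring, zero_add] at h
  exact h

/-- **THE CYLINDER FORMULA, iterated form**: for `f` integrable on the solid cylinder, `s₁ ≤ s₂` and `0 ≤ T₀`,
`∫_{solidCyl s₁ s₂ T₀} f = ∫_{s₁}^{s₂} ∫₀^{T₀} t • (∫₀^{2π} f (axisPt σ t θ) dθ) dt dσ` (Fubini on the coordinate box).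
[folklore] -/
theorem setIntegral_solidCyl_eq {F : Type*} [NormedAddCommGroup F] [NormedSpace ℝ F]
    (f : EuclideanSpace ℝ (Fin 3) → F) {s₁ s₂ T₀ : ℝ} (hf : IntegrableOn f (solidCyl s₁ s₂ T₀))
    (hs : s₁ ≤ s₂) (hT : 0 ≤ T₀) :
    ∫ y in solidCyl s₁ s₂ T₀, f y
      = ∫ σ in s₁..s₂, ∫ t in (0 : ℝ)..T₀, t • ∫ θ in (0 : ℝ)..2 * π, f (axisPt σ t θ) := by
  have hI := (integrableOn_solidCyl_iff f s₁ s₂ T₀).1 hf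
  rw [setIntegral_solidCyl_eq_setIntegral_box]
  -- outer Fubini: `σ` against `(t, θ)`
  have hI' : Integrable (fun p : ℝ × (ℝ × ℝ) => p.2.1 • f (axisPt p.1 p.2.1 p.2.2))
      ((volume.restrict (Icc s₁ s₂)).prod (volume.restrict (Ioc 0 T₀ ×ˢ Ioo (-π) π))) := by
    rw [Measure.prod_restrict]
    exact hI
  have hF1 : ∫ p in Icc s₁ s₂ ×ˢ (Ioc 0 T₀ ×ˢ Ioo (-π) π), p.2.1 • f (axisPt p.1 p.2.1 p.2.2)
      = ∫ σ in Icc s₁ s₂, ∫ q in Ioc 0 T₀ ×ˢ Ioo (-π) π, q.1 • f (axisPt σ q.1 q.2) :=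
    setIntegral_prod _ hI
  -- inner Fubini: `t` against `θ`, for a.e. `σ`
  have hae : ∀ᵐ σ ∂(volume.restrict (Icc s₁ s₂)),
      Integrable (fun q : ℝ × ℝ => q.1 • f (axisPt σ q.1 q.2)) (volume.restrict (Ioc 0 T₀ ×ˢ Ioo (-π) π)) :=
    hI'.prod_right_ae
  have hF2 : ∫ σ in Icc s₁ s₂, ∫ q in Ioc 0 T₀ ×ˢ Ioo (-π) π, q.1 • f (axisPt σ q.1 q.2)
      = ∫ σ in Icc s₁ s₂, ∫ t in Ioc 0 T₀, ∫ θ in Ioo (-π) π, t • f (axisPt σ t θ) := by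
    refine integral_congr_ae (hae.mono fun σ hσ => ?_)
    exact setIntegral_prod _ hσ
  rw [hF1, hF2, ← setIntegral_congr_set (Ioc_ae_eq_Icc : Ioc s₁ s₂ =ᵐ[(volume : Measure ℝ)] Icc s₁ s₂),
    intervalIntegral.integral_of_le hs]
  simp only [setIntegral_Ioo_smul_axisPt, intervalIntegral.integral_of_le hT]

/-- **THE CYLINDER FORMULA with azimuthal averages** (real-valued `f` integrable on the cylinder, `s₁ ≤ s₂`,
`0 ≤ T₀`): `∫_{solidCyl s₁ s₂ T₀} f = 2π ∫_{s₁}^{s₂} ∫₀^{T₀} t · circleAvg f σ t dt dσ`. [folklore] -/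
theorem setIntegral_solidCyl_eq_circleAvg (f : EuclideanSpace ℝ (Fin 3) → ℝ) {s₁ s₂ T₀ : ℝ}
    (hf : IntegrableOn f (solidCyl s₁ s₂ T₀)) (hs : s₁ ≤ s₂) (hT : 0 ≤ T₀) :
    ∫ y in solidCyl s₁ s₂ T₀, f y
      = 2 * π * ∫ σ in s₁..s₂, ∫ t in (0 : ℝ)..T₀, t * circleAvg f σ t := by
  rw [setIntegral_solidCyl_eq f hf hs hT]
  have hπ : (2 : ℝ) * π ≠ 0 := by positivity
  have key : ∀ σ t : ℝ,
      (t • ∫ θ in (0 : ℝ)..2 * π, f (axisPt σ t θ)) = 2 * π * (t * circleAvg f σ t) := by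
    intro σ t
    rw [circleAvg, smul_eq_mul]
    field_simp
  simp only [key, intervalIntegral.integral_const_mul]

end Summit.NavierStokesRegularity.NavierStokesRegularity.Theorems.PowerGaugeEulerLiouville.HoopCore

end
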